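import Summits.Ventures.PercRepro.RankDistDirectSum

/-!
# PercRepro — THE ROW (SC) IS CLOSED UNDER DIRECT SUMS (modulo TOP): if both factors satisfy the cumulative shadow
inequality up to and including their top level, so does their direct sum (p9, gen 22)

`ShadowCumulativeTop M p q`: `s_q · C(n, v) ≤ s_v · C(n, q)` for every `q ≤ v ≤ p` (the lane's row (SC),
`ShadowCumulative`, extended to the two ends: `v = q` is trivial and `v = p` is TOP, `s_q ≤ s_p`, as
`C(n, p) = C(n, q)`). **THEOREM (`shadowCumulative_disjointSum`)**: on tight layers (`|E_M| = p₁ + q₁`, `ρ(M) = p₁`,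
`|E_N| = p₂ + q₂`, `ρ(N) = p₂`, `q_i ≤ p_i`), `ShadowCumulativeTop M p₁ q₁` and `ShadowCumulativeTop N p₂ q₂` give
`ShadowCumulative (M ⊕ N) (p₁ + p₂) (q₁ + q₂)` — and with `rls_of_shadowCumulative`, C-025 for the sum
(`rls_disjointSum`). PROOF: `s_u(M ⊕ N) = Σ_v s_v(M) s_{u−v}(N)` (`card_shadowLev_disjointSum`) is at least the sum
over the window `W_u = [max(q₁, u − p₂), min(p₁, u − q₂)]`, where each factor is bounded below by its (SC):
`s_v(M) · C(n₁, q₁) ≥ s_{q₁} · C(n₁, v)`, `s_{u−v}(N) · C(n₂, q₂) ≥ s_{q₂} · C(n₂, u − v)`; the window sum of the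
binomials is `#winFam u` (`card_winFam_eq_sum`), and the restricted Vandermonde inequality
`C(n₁, q₁) C(n₂, q₂) C(n, u) ≤ #winFam u · C(n, q)` (`card_winFam_mul_choose_ge`) closes:
`s_u · C(n, q) · C(n₁, q₁) C(n₂, q₂) ≥ s_{q₁} s_{q₂} · #winFam u · C(n, q) ≥ s_{q₁} s_{q₂} C(n₁, q₁) C(n₂, q₂) C(n, u)
= s_q · C(n, u) · C(n₁, q₁) C(n₂, q₂)`, with `s_q(M ⊕ N) = s_{q₁} s_{q₂}` (`card_shadowLev_disjointSum_bot`). ∎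
So the row (SC) — and C-025 through it — reduces, modulo TOP, to CONNECTED tight-layer cells. TOP is a known
non-core failure mode (g19); on every core cell of the censuses it held. Nothing here moves any window of the
crux: it is a closure statement, not a window.
-/

namespace PercRepro.RankDist

open Set Finset _root_.Matroid PercRepro.ThmH

variable {α : Type} [DecidableEq α]

/-- The cumulative shadow inequality INCLUDING the two ends `v = q` (trivial) and `v = p` (TOP: `s_q ≤ s_p`). -/
def ShadowCumulativeTop (M : Matroid α) [M.Finite] (p q : ℕ) : Prop :=
  ∀ v, q ≤ v → v ≤ p →
    (shadowLev M q (PerFlat.Uq M p q)).card * (p + q).choose v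
      ≤ (shadowLev M v (PerFlat.Uq M p q)).card * (p + q).choose q

/-! ## The window sum of binomials is the window family -/

/-- **The window family counted by the `L`-count**: `#winFam u = Σ_{v ∈ W_u} C(|L|, v) · C(|R|, u − v)` for
`q₁ + q₂ ≤ u` (below `q₁ + q₂` the truncated window `[max(q₁, u − p₂), min(p₁, u − q₂)]` would be wrong). -/
lemma card_winFam_eq_sum {L R : Finset α} (hLR : Disjoint L R) {q₁ p₁ q₂ p₂ u : ℕ} (hqu : q₁ + q₂ ≤ u) :
    (winFam L R q₁ p₁ q₂ p₂ u).card
      = ∑ v ∈ Finset.Icc (max q₁ (u - p₂)) (min p₁ (u - q₂)), L.card.choose v * R.card.choose (u - v) := by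
  rw [Finset.card_eq_sum_card_fiberwise (f := fun X => (X ∩ L).card)
    (t := Finset.Icc (max q₁ (u - p₂)) (min p₁ (u - q₂)))]
  · refine Finset.sum_congr rfl fun v hv => ?_
    rw [Finset.mem_Icc, max_le_iff, le_min_iff] at hv
    obtain ⟨⟨hv1, hv2⟩, hv3, hv4⟩ := hv
    have hvu : v ≤ u := by omega
    have h := card_filter_card_inter_eq hLR (L := L) (R := R) (u := u) (b := u - v) (by omega)
    rw [Nat.sub_sub_self hvu] at h
    rw [← h]
    congr 1
    ext X
    rw [Finset.mem_filter, mem_winFam, Finset.mem_filter, Finset.mem_powersetCard]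
    constructor
    · rintro ⟨⟨hX, hXu, -, -, -, -⟩, hXv⟩
      have hsum := card_inter_add_card_inter hLR hX
      exact ⟨⟨hX, hXu⟩, by omega⟩
    · rintro ⟨⟨hX, hXu⟩, hXb⟩
      have hsum := card_inter_add_card_inter hLR hX
      exact ⟨⟨hX, hXu, by omega, by omega, by omega, by omega⟩, by omega⟩
  · intro X hX
    rw [Finset.mem_coe, mem_winFam] at hX
    obtain ⟨hX, hXu, h1, h2, h3, h4⟩ := hX
    have hsum := card_inter_add_card_inter hLR hX
    rw [Finset.mem_coe, Finset.mem_Icc, max_le_iff, le_min_iff]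
    show (q₁ ≤ (X ∩ L).card ∧ u - p₂ ≤ (X ∩ L).card) ∧ (X ∩ L).card ≤ p₁ ∧ (X ∩ L).card ≤ u - q₂
    omega

/-! ## The closure -/

/-- **THE ROW (SC) IS CLOSED UNDER DIRECT SUMS, MODULO TOP**: tight layers `(p₁, q₁)`, `(p₂, q₂)` with
`q_i ≤ p_i`; if both factors satisfy `ShadowCumulativeTop`, the direct sum satisfies `ShadowCumulative` at
`(p₁ + p₂, q₁ + q₂)`. -/
theorem shadowCumulative_disjointSum (M N : Matroid α) [M.Finite] [N.Finite] (h : Disjoint M.E N.E)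
    [hS : (M.disjointSum N h).Finite] {p₁ q₁ p₂ q₂ : ℕ} (hn₁ : (gr M).card = p₁ + q₁)
    (hr₁ : M.eRank = (p₁ : ℕ∞)) (hn₂ : (gr N).card = p₂ + q₂) (hr₂ : N.eRank = (p₂ : ℕ∞))
    (hq₁ : q₁ ≤ p₁) (hq₂ : q₂ ≤ p₂) (hM : ShadowCumulativeTop M p₁ q₁) (hN : ShadowCumulativeTop N p₂ q₂) :
    ShadowCumulative (M.disjointSum N h) (p₁ + p₂) (q₁ + q₂) := by
  intro u hqu hup
  have hgrM : (gr M : Set α) = M.E := coe_gr M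
  have hgrN : (gr N : Set α) = N.E := coe_gr N
  have hgrdisj : Disjoint (gr M) (gr N) := by
    rw [← Finset.disjoint_coe, hgrM, hgrN]
    exact h
  have hn : (gr M ∪ gr N).card = p₁ + p₂ + (q₁ + q₂) := by
    rw [Finset.card_union_of_disjoint hgrdisj, hn₁, hn₂]
    ring
  -- the window sum of the factors' shadow levels bounds the convolution from below
  set W := Finset.Icc (max q₁ (u - p₂)) (min p₁ (u - q₂)) with hW
  have hWsub : W ⊆ Finset.range (u + 1) := by
    intro v hv
    rw [hW, Finset.mem_Icc, max_le_iff, le_min_iff] at hv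
    rw [Finset.mem_range]
    omega
  have hconv := card_shadowLev_disjointSum M N h hn₁ hr₁ hn₂ hr₂ u
  have hbot := card_shadowLev_disjointSum_bot M N h hn₁ hr₁ hn₂ hr₂
  have h1 : ∑ v ∈ W, (shadowLev M v (PerFlat.Uq M p₁ q₁)).card * (shadowLev N (u - v) (PerFlat.Uq N p₂ q₂)).card
      ≤ (shadowLev (M.disjointSum N h) u (PerFlat.Uq (M.disjointSum N h) (p₁ + p₂) (q₁ + q₂))).card := by
    rw [hconv]
    exact Finset.sum_le_sum_of_subset_of_nonneg hWsub (fun _ _ _ => Nat.zero_le _)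
  -- each term: the factors' (SC) at `v` and `u − v`
  have h2 : ∀ v ∈ W,
      (shadowLev M q₁ (PerFlat.Uq M p₁ q₁)).card * (shadowLev N q₂ (PerFlat.Uq N p₂ q₂)).card
          * ((gr M).card.choose v * (gr N).card.choose (u - v))
        ≤ (shadowLev M v (PerFlat.Uq M p₁ q₁)).card * (shadowLev N (u - v) (PerFlat.Uq N p₂ q₂)).card
          * ((gr M).card.choose q₁ * (gr N).card.choose q₂) := by
    intro v hv
    rw [hW, Finset.mem_Icc, max_le_iff, le_min_iff] at hv
    have hMv := hM v (by omega) (by omega)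
    have hNv := hN (u - v) (by omega) (by omega)
    rw [← hn₁] at hMv
    rw [← hn₂] at hNv
    calc (shadowLev M q₁ (PerFlat.Uq M p₁ q₁)).card * (shadowLev N q₂ (PerFlat.Uq N p₂ q₂)).card
          * ((gr M).card.choose v * (gr N).card.choose (u - v))
        = ((shadowLev M q₁ (PerFlat.Uq M p₁ q₁)).card * (gr M).card.choose v)
          * ((shadowLev N q₂ (PerFlat.Uq N p₂ q₂)).card * (gr N).card.choose (u - v)) := by ring
      _ ≤ ((shadowLev M v (PerFlat.Uq M p₁ q₁)).card * (gr M).card.choose q₁)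
          * ((shadowLev N (u - v) (PerFlat.Uq N p₂ q₂)).card * (gr N).card.choose q₂) :=
          Nat.mul_le_mul hMv hNv
      _ = _ := by ring
  -- sum the termwise bounds
  have h3 : (shadowLev M q₁ (PerFlat.Uq M p₁ q₁)).card * (shadowLev N q₂ (PerFlat.Uq N p₂ q₂)).card
        * (winFam (gr M) (gr N) q₁ p₁ q₂ p₂ u).card
      ≤ (∑ v ∈ W, (shadowLev M v (PerFlat.Uq M p₁ q₁)).card * (shadowLev N (u - v) (PerFlat.Uq N p₂ q₂)).card)
        * ((gr M).card.choose q₁ * (gr N).card.choose q₂) := by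
    rw [card_winFam_eq_sum hgrdisj hqu.le, ← hW, Finset.mul_sum, Finset.sum_mul]
    exact Finset.sum_le_sum h2
  -- the restricted Vandermonde inequality
  have h4 := card_winFam_mul_choose_ge hgrdisj hn₁ hn₂ hq₁ hq₂ hqu.le hup.le
  rw [hn] at h4
  -- assemble and cancel `C(n₁, q₁) · C(n₂, q₂) > 0`
  have hpos : 0 < (gr M).card.choose q₁ * (gr N).card.choose q₂ :=
    Nat.mul_pos (Nat.choose_pos (by omega)) (Nat.choose_pos (by omega))
  rw [hbot]
  refine Nat.le_of_mul_le_mul_right ?_ hpos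
  calc (shadowLev M q₁ (PerFlat.Uq M p₁ q₁)).card * (shadowLev N q₂ (PerFlat.Uq N p₂ q₂)).card
        * (p₁ + p₂ + (q₁ + q₂)).choose u * ((gr M).card.choose q₁ * (gr N).card.choose q₂)
      = (shadowLev M q₁ (PerFlat.Uq M p₁ q₁)).card * (shadowLev N q₂ (PerFlat.Uq N p₂ q₂)).card
        * ((gr M).card.choose q₁ * (gr N).card.choose q₂ * (p₁ + p₂ + (q₁ + q₂)).choose u) := by ring
    _ ≤ (shadowLev M q₁ (PerFlat.Uq M p₁ q₁)).card * (shadowLev N q₂ (PerFlat.Uq N p₂ q₂)).card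
        * ((winFam (gr M) (gr N) q₁ p₁ q₂ p₂ u).card * (p₁ + p₂ + (q₁ + q₂)).choose (q₁ + q₂)) :=
        Nat.mul_le_mul_left _ h4
    _ = ((shadowLev M q₁ (PerFlat.Uq M p₁ q₁)).card * (shadowLev N q₂ (PerFlat.Uq N p₂ q₂)).card
        * (winFam (gr M) (gr N) q₁ p₁ q₂ p₂ u).card) * (p₁ + p₂ + (q₁ + q₂)).choose (q₁ + q₂) := by ring
    _ ≤ ((∑ v ∈ W, (shadowLev M v (PerFlat.Uq M p₁ q₁)).card * (shadowLev N (u - v) (PerFlat.Uq N p₂ q₂)).card)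
        * ((gr M).card.choose q₁ * (gr N).card.choose q₂)) * (p₁ + p₂ + (q₁ + q₂)).choose (q₁ + q₂) :=
        Nat.mul_le_mul_right _ h3
    _ ≤ ((shadowLev (M.disjointSum N h) u (PerFlat.Uq (M.disjointSum N h) (p₁ + p₂) (q₁ + q₂))).card
        * ((gr M).card.choose q₁ * (gr N).card.choose q₂)) * (p₁ + p₂ + (q₁ + q₂)).choose (q₁ + q₂) :=
        Nat.mul_le_mul_right _ (Nat.mul_le_mul_right _ h1)
    _ = _ := by ring

/-- **C-025 FOR A DIRECT SUM OF TIGHT-LAYER CELLS WITH (SC) + TOP**: `ThmN.RLS (M ⊕ N) (p₁ + p₂) (q₁ + q₂)`. -/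
theorem rls_disjointSum (M N : Matroid α) [M.Finite] [N.Finite] (h : Disjoint M.E N.E)
    [hS : (M.disjointSum N h).Finite] {p₁ q₁ p₂ q₂ : ℕ} (hn₁ : (gr M).card = p₁ + q₁)
    (hr₁ : M.eRank = (p₁ : ℕ∞)) (hn₂ : (gr N).card = p₂ + q₂) (hr₂ : N.eRank = (p₂ : ℕ∞))
    (hq₁ : q₁ ≤ p₁) (hq₂ : q₂ ≤ p₂) (hM : ShadowCumulativeTop M p₁ q₁) (hN : ShadowCumulativeTop N p₂ q₂) :
    ThmN.RLS (M.disjointSum N h) (p₁ + p₂) (q₁ + q₂) :=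
  rls_of_shadowCumulative _ _ _ (shadowCumulative_disjointSum M N h hn₁ hr₁ hn₂ hr₂ hq₁ hq₂ hM hN)

end PercRepro.RankDist
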